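import Summits.AnomalousDissipation.AnomalousDissipation.Theorems.SawtoothPulseCascadeK1LocalisedCascadeLedgerThinClose

/-!
# Sketch — crux idea `renormalised-escape-weight` (ad-ideate-p4, lens `control`)
for `stmt-AnomalousDissipation-19491` = `…Theses.SawtoothPulseCascade.K1LocalisedCascade`.

The controlling quantity: the SATURATED HORIZONTAL `Ḣ^{-s}` PROGRESS FUNCTIONAL of the inviscid iterates
`Φ_n(c) = Σ_ξ min(1, (c r^n/|ξ₀|)^{2s}) |â_n(ξ)|²` (`r = γ² − 3`, `s = 1/4`, weight `1` on the column `ξ₀ = 0`).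
First lemmas (signatures only; nothing here is proved):
* `HStepInvariance` — the `ξ₀`-marginal spectrum, hence `Φ_n`, is EXACTLY invariant under every H half-step;
* `SymbolChannelSplit` — the S-D tracked start energy `Σ μ_n² |â_n|²` (`μ_n = 1 − gˢ·g^env` is `1` on the low band
  `|k₀| < (1+1/250)c r^n`, on the HIGH OFF-CONE modes and outside the envelope, and `0` on the released core) is
  `≤ (1+1/250)^{2s} Φ_n(c) + highOffConeEnergy + envelopeExcess` (routine: `μ² ≤ 1`, `μ = 0` on the released core);
* `OffConeTransient` — the high off-cone channel is TRANSIENT (clean phases return off-cone parcels to the cone; it is fed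
  only by the zone cores of the previous phase): `≤ C θ^n`; `EnvelopeTail` — the envelope channel is `≤ C θ^n` (gradient bound, routine);
* `HorizontalMixFloor` — the conjectured uniform bound `Φ_n(c) ≤ M c^{2s} ‖datum‖²` (constant `M` free, `c` free);
* `K1LocalisedOfChannelBound` — the transfer target: eventual channel bound ⇒ `K1Localised P (γ²−3)` via
  `K1Ledger.From.k1Localised_of_thin_iterate_bound`; `ChannelBoundOfFloors` — mix floor + the two transient channels ⇒ the
  eventual bound (choose `c` with `(1+1/250)^{2s} M c^{2s} < 1`, then `i₁` large).
-/

set_option linter.dupNamespace false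

noncomputable section

namespace Summit.AnomalousDissipation.AnomalousDissipation.Cruxes.K1LocalisedCascade.HorizontalProgress

open MeasureTheory Set Filter Topology UnitAddTorus Function
open Literature.Analysis Literature.Analysis.FunctionSpaces Literature.Analysis.FunctionSpaces.Torus Literature.Analysis.FluidPDE
open Literature.Analysis.FluidPDE.ShearStage
open Literature.Analysis.FluidPDE.SawtoothCascade Literature.Analysis.FluidPDE.SawtoothCascade.CascadeParams

/-- Saturated horizontal weight `min(1, (c r^n / |ξ₀|)^{2s})`, `= 1` on the column `ξ₀ = 0`. -/
def horizontalWeight (c r s : ℝ) (n : ℕ) (ξ₀ : ℤ) : ℝ :=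
  if ξ₀ = 0 then 1 else min 1 ((c * r ^ n / |(ξ₀ : ℝ)|) ^ (2 * s))

/-- The horizontal progress functional `Φ_n(c) = Σ_k w(k 0) |𝓕f(k)|²` of a scalar `f` on `𝕋²`. -/
def horizontalProgress (c r s : ℝ) (n : ℕ) (f : UnitAddTorus (Fin 2) → ℝ) : ℝ :=
  ∑' k : Fin 2 → ℤ, horizontalWeight c r s n (k 0) * ‖mFourierCoeff (fun x => (f x : ℂ)) k‖ ^ 2

/-- FIRST LEMMA (L0). Exact H-step invariance of the `ξ₀`-marginal spectrum: `b = a ∘ (x ↦ x − φ(x₁)e₀)` is, for each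
`x₁`, a translate of `a(·, x₁)`, so `Σ_{ξ₁} |b̂(ξ₀,ξ₁)|² = ∫ |â(ξ₀; x₁)|² dx₁ = Σ_{ξ₁} |â(ξ₀,ξ₁)|²` for every profile `φ`. -/
def HStepInvariance : Prop :=
  ∀ (φ : ShearProfile) (a : UnitAddTorus (Fin 2) → ℝ), IsSmooth a → ∀ ξ₀ : ℤ,
    ∑' ξ₁ : ℤ, ‖mFourierCoeff (fun x => ((a ∘ shearMap 0 1 φ) x : ℂ)) ![ξ₀, ξ₁]‖ ^ 2 =
      ∑' ξ₁ : ℤ, ‖mFourierCoeff (fun x => (a x : ℂ)) ![ξ₀, ξ₁]‖ ^ 2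

/-- Corollary shape of L0 for the functional: `Φ_n(c)(a ∘ H⁻¹) = Φ_n(c)(a)`. -/
def ProgressHInvariant (c r s : ℝ) : Prop :=
  ∀ (φ : ShearProfile) (a : UnitAddTorus (Fin 2) → ℝ), IsSmooth a → ∀ n : ℕ,
    horizontalProgress c r s n (a ∘ shearMap 0 1 φ) = horizontalProgress c r s n a

/-- The HIGH OFF-CONE channel: energy of `f` in the modes `|k₀| ≥ (1+1/250)L ∧ 13/10·|k₀| < γ|k₁|` (radially released
but outside the unstable cone — the start symbol is `1` there). -/
def highOffConeEnergy (γ L : ℝ) (f : UnitAddTorus (Fin 2) → ℝ) : ℝ :=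
  ∑' k : Fin 2 → ℤ, (if (1 + 1 / 250) * L ≤ |((k 0 : ℤ) : ℝ)| ∧ 13 / 10 * |((k 0 : ℤ) : ℝ)| < γ * |((k 1 : ℤ) : ℝ)|
      then (1 : ℝ) else 0) * ‖mFourierCoeff (fun x => (f x : ℂ)) k‖ ^ 2

/-- The ENVELOPE channel: energy of `f` in the modes `|k₀| > R ∨ |k₁| > R`. -/
def envelopeExcess (R : ℝ) (f : UnitAddTorus (Fin 2) → ℝ) : ℝ :=
  ∑' k : Fin 2 → ℤ, (if R < |((k 0 : ℤ) : ℝ)| ∨ R < |((k 1 : ℤ) : ℝ)| then (1 : ℝ) else 0) *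
    ‖mFourierCoeff (fun x => (f x : ℂ)) k‖ ^ 2

/-- The envelope radius `R_n = 2c(γ²−3)^n (Γ/ρ₀)^n` of the S-D closer (`Γ = (1+γ)²+1`). -/
def envelopeRadius (γ c Lm : ℝ) (n : ℕ) : ℝ :=
  2 * (c * (γ ^ 2 - 3) ^ n / ((γ ^ 2 - 5 / 2) / (1 + 1 / 250) ^ 2 - 1 / (2 * (1 + 1 / 250) * Lm)) ^ n) * ((1 + γ) ^ 2 + 1) ^ n

/-- L1 (routine). THREE-CHANNEL SPLIT of the S-D tracked start energy: the symbol `μ_n = 1 − gˢ_L·g^env` of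
`k1Localised_of_thin_iterate_bound` (`L = c(γ²−3)^n`) has `μ_n² ≤ 1` and VANISHES on the released core
`{|k₀| ≥ (1+1/250)L} ∩ {γ|k₁| ≤ 13/10·|k₀|} ∩ {|k₀|,|k₁| ≤ R_n}` (`K1Ledger.From.symProdS_eq_zero_of_released`), so
`Σ μ_n²|f̂|² ≤ (low band, where the horizontal weight is ≥ (1+1/250)^{-2s}) + (high off-cone) + (outside the envelope)`. -/
def SymbolChannelSplit (γ c Lm s : ℝ) : Prop :=
  ∀ (n : ℕ) (f : UnitAddTorus (Fin 2) → ℝ), IsSmooth f → 0 ≤ s → 0 < c →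
    ∑' k : Fin 2 → ℤ, (1 - Real.smoothTransition ((|((k 0 : ℤ) : ℝ)| - c * (γ ^ 2 - 3) ^ n) /
            (1 / 250 * (c * (γ ^ 2 - 3) ^ n))) *
          (1 - Real.smoothTransition ((γ * |((k 1 : ℤ) : ℝ)| - 13 / 10 * |((k 0 : ℤ) : ℝ)|) /
            (1 / 20 * (c * (γ ^ 2 - 3) ^ n)))) *
        ((1 - Real.smoothTransition ((|((k 0 : ℤ) : ℝ)| - envelopeRadius γ c Lm n) /
            (c * (γ ^ 2 - 3) ^ n / (20 * γ * (1 + 1 / 250))))) *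
          (1 - Real.smoothTransition ((|((k 1 : ℤ) : ℝ)| - envelopeRadius γ c Lm n) /
            (c * (γ ^ 2 - 3) ^ n / (20 * γ * (1 + 1 / 250))))))) ^ 2 * ‖mFourierCoeff (fun x => (f x : ℂ)) k‖ ^ 2
      ≤ (1 + 1 / 250) ^ (2 * s) * horizontalProgress c (γ ^ 2 - 3) s n f +
        highOffConeEnergy γ (c * (γ ^ 2 - 3) ^ n) f + envelopeExcess (envelopeRadius γ c Lm n) f

/-- L1′ — conjecture (part of the Lyapunov package). The high off-cone channel of the inviscid iterates is TRANSIENT: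
a clean phase maps every off-cone parcel back into the cone, so the channel at phase `n` is fed only by the zone cores of
phase `n − 1` (measure `≈ 2.3·δ₀2^{-(n-1)}`) up to semiclassical errors `O((4/(γ²−3))^n/(cδ₀))`: geometric decay. -/
def OffConeTransient (P : CascadeParams) (c : ℝ) : Prop :=
  ∃ C : ℝ, ∃ θ ∈ Set.Ioo (0 : ℝ) 1, ∀ (hδ₀ : 0 < P.δ₀) (hd : 0 < P.d) (a b : ℕ → UnitAddTorus (Fin 2) → ℝ),
    (∀ j, IsSmooth (a j)) → a 0 = datum →
    (∀ j, b j = a j ∘ shearMap 0 1 (amp ⟨P.U j, P.U_periodic j, P.contDiff_U (P.δ_pos hδ₀ hd j)⟩ P.γ)) →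
    (∀ j, a (j + 1) = b j ∘ shearMap 1 0 (amp ⟨P.U j, P.U_periodic j, P.contDiff_U (P.δ_pos hδ₀ hd j)⟩ P.γ)) →
    ∀ n : ℕ, highOffConeEnergy P.γ (c * (P.γ ^ 2 - 3) ^ n) (a n) ≤ C * θ ^ n

/-- L1″ (routine). The envelope channel decays geometrically: `‖∇a_n‖₂² ≤ ‖DΨ‖_op^{2n}‖∇datum‖₂²` with
`‖DΨ‖_op² ≤ (1+γ²)² + 2γ² + 1 < Γ²(γ²−3)²/ρ₀²`, and Chebyshev in frequency. -/
def EnvelopeTail (P : CascadeParams) (c Lm : ℝ) : Prop :=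
  ∃ C : ℝ, ∃ θ ∈ Set.Ioo (0 : ℝ) 1, ∀ (hδ₀ : 0 < P.δ₀) (hd : 0 < P.d) (a b : ℕ → UnitAddTorus (Fin 2) → ℝ),
    (∀ j, IsSmooth (a j)) → a 0 = datum →
    (∀ j, b j = a j ∘ shearMap 0 1 (amp ⟨P.U j, P.U_periodic j, P.contDiff_U (P.δ_pos hδ₀ hd j)⟩ P.γ)) →
    (∀ j, a (j + 1) = b j ∘ shearMap 1 0 (amp ⟨P.U j, P.U_periodic j, P.contDiff_U (P.δ_pos hδ₀ hd j)⟩ P.γ)) →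
    ∀ n : ℕ, envelopeExcess (envelopeRadius P.γ c Lm n) (a n) ≤ C * θ ^ n

/-- L2 — THE CONJECTURE (controlling quantity). Uniform horizontal mix floor of the inviscid iterates of `datum`
along the cascade `P` (shape P: `N₀ = 1`, `ρN = 2`, `d = 2`): `Φ_n(c) ≤ M c^{2s} ‖datum‖²` for all `n` and all `c ∈ (0,1]`. -/
def HorizontalMixFloor (P : CascadeParams) (s : ℝ) : Prop :=
  ∃ M : ℝ, ∀ c ∈ Set.Ioc (0 : ℝ) 1, ∀ (hδ₀ : 0 < P.δ₀) (hd : 0 < P.d) (a b : ℕ → UnitAddTorus (Fin 2) → ℝ),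
    (∀ j, IsSmooth (a j)) → a 0 = datum →
    (∀ j, b j = a j ∘ shearMap 0 1 (amp ⟨P.U j, P.U_periodic j, P.contDiff_U (P.δ_pos hδ₀ hd j)⟩ P.γ)) →
    (∀ j, a (j + 1) = b j ∘ shearMap 1 0 (amp ⟨P.U j, P.U_periodic j, P.contDiff_U (P.δ_pos hδ₀ hd j)⟩ P.γ)) →
    ∀ n : ℕ, horizontalProgress c (P.γ ^ 2 - 3) s n (a n) ≤ M * c ^ (2 * s) * Torus.scalarL2Sq datum

/-- The form actually consumed by the S-D closer: ONE `c`, ONE `q < ‖datum‖`, eventually in `n`, all three channels. -/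
def EventualChannelBound (P : CascadeParams) (Lm s : ℝ) : Prop :=
  ∃ c > (0 : ℝ), ∃ q : ℝ, 0 ≤ q ∧ q < Real.sqrt (Torus.scalarL2Sq datum) ∧ ∃ i₁ : ℕ,
    ∀ (hδ₀ : 0 < P.δ₀) (hd : 0 < P.d) (a b : ℕ → UnitAddTorus (Fin 2) → ℝ),
    (∀ j, IsSmooth (a j)) → a 0 = datum →
    (∀ j, b j = a j ∘ shearMap 0 1 (amp ⟨P.U j, P.U_periodic j, P.contDiff_U (P.δ_pos hδ₀ hd j)⟩ P.γ)) →
    (∀ j, a (j + 1) = b j ∘ shearMap 1 0 (amp ⟨P.U j, P.U_periodic j, P.contDiff_U (P.δ_pos hδ₀ hd j)⟩ P.γ)) →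
    ∀ n : ℕ, i₁ ≤ n →
      (1 + 1 / 250) ^ (2 * s) * horizontalProgress c (P.γ ^ 2 - 3) s n (a n) +
        highOffConeEnergy P.γ (c * (P.γ ^ 2 - 3) ^ n) (a n) + envelopeExcess (envelopeRadius P.γ c Lm n) (a n) ≤ q ^ 2

/-- L3 — the transfer target of the line (shape P, `5 ≤ γ ≤ 8`, `0 < δ₀ ≤ 1/4`, `L_min ≥ 1000`):
eventual three-channel bound at `s = 1/4` ⇒ the crux conjunct `K1Localised P (γ² − 3)`, via `SymbolChannelSplit` and
`K1Ledger.From.k1Localised_of_thin_iterate_bound`. -/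
def K1LocalisedOfChannelBound : Prop :=
  ∀ (P : CascadeParams) (Lm : ℝ), 1000 ≤ Lm → 5 ≤ P.γ → P.γ ≤ 8 → 0 < P.δ₀ → P.δ₀ ≤ 1 / 4 → P.d = 2 → P.N₀ = 1 →
    P.ρN = 2 → EventualChannelBound P Lm (1 / 4) → K1Localised P (P.γ ^ 2 - 3)

/-- Glue (logic + limits): the mix floor (all `c`), the transient off-cone channel and the envelope tail give the eventual
bound — pick `c` with `(1+1/250)^{2s} M c^{2s} < 1`, then `i₁` with `2Cθ^{i₁}` below the remaining room. -/
def ChannelBoundOfFloors : Prop :=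
  ∀ (P : CascadeParams) (Lm s : ℝ), 0 < s → HorizontalMixFloor P s →
    (∀ c ∈ Set.Ioc (0 : ℝ) 1, OffConeTransient P c) → (∀ c ∈ Set.Ioc (0 : ℝ) 1, EnvelopeTail P c Lm) →
    EventualChannelBound P Lm s

end Summit.AnomalousDissipation.AnomalousDissipation.Cruxes.K1LocalisedCascade.HorizontalProgress
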